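import Literature.MathematicalPhysics.QuantumLattice.PropMatrixUniformDeterminantBound
import HarnessLib

/-!
# Weighted minors of chronological propagator matrices: the determinant bound `δ = 2`

Continuation of `PropMatrixUniformDeterminantBound.lean` (`‖det (propMatrix β h op om t)‖ ≤ 2ⁿ` for
real antitone pair times in a window of length `β`, from the Pedra–Salmhofer mode bound
`MatsubaraDeterminantBound.norm_det_timeOrdered_modes_le`). The multiscale / cluster-expansion
machinery consumes a stronger, STABLE form of such a bound — the "determinant bound" of a covariance
in the sense of Salmhofer–Wieczerkowski and Pedra–Salmhofer (CMP 282 (2008) 797, Def. before Thm 1.3):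
the same constant must control every square MINOR (rows and columns chosen independently among the
field pairs — what is left of the determinant after the Brydges–Battle–Federbush tree lines have used
some rows) and must survive multiplying the entries by GRAM WEIGHTS `⟨w_a, w'_b⟩` (the interpolation
factors `s_{c(a) c(b)}(t) = ⟨u_{c(a)}(t), u_{c(b)}(t)⟩` of the tree expansion, `BattleFederbushGram`,
`FermionicTreeExpansionBounds`). This file proves that form for `propMatrix`:

* `iff_lt_card_filter_of_lower` — a downward-closed predicate on `Fin n` is an initial segment
  (the staircase pattern of the chronological indicator after monotone row/column selections);
* **`norm_det_weighted_propMatrix_minor_le`** — for Hermitian `h`, real `β`, `N` pairs with orbitals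
  `op, om` and real antitone times in a window of length `β`, complex weight vectors `w, w' : Fin N → m → ℂ`
  and monotone selections `er, ec : Fin n → Fin N`:
  `‖det (⟨w_{er a}, w'_{ec b}⟩ · G_{er a, ec b})_{a b}‖ ≤ 2ⁿ ∏ₐ ‖w_{er a}‖₂ ∏_b ‖w'_{ec b}‖₂`,
  `G = propMatrix β h op om t` — uniformly in `β`, `h`, `N` and the number of orbitals (tensor the unit
  eigen-mode vectors of `Matrix.IsHermitian.propagatorKernel_apply` with the weights);
* `norm_det_propMatrix_minor_le_two_pow` — in particular every square minor `G[R, C]` has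
  `‖det‖ ≤ 2^{|R|}`.

Everything is PROVED; no definition and no named fact.

## Mathlib / tree search
Tree: `norm_det_timeOrdered_modes_le` (`MatsubaraDeterminantBound`), `propMatrix` (`HubbardLinkedCluster`),
`Matrix.IsHermitian.propagatorKernel_apply`, `norm_det_propMatrix_le_two_pow`
(`PropMatrixUniformDeterminantBound`), `Matrix.sum_norm_sq_row_eq_one` (`DuhamelTwoPoint`),
`lt_iff_lt_card_filter_of_antitone` (`ChronologicalGramBoundTimes`, the same staircase device for time
labels). Mathlib: `Fin.card_Iic`, `Fin.card_Iio`, `Fintype.sum_prod_type`, `Finset.sum_mul_sum`.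

## References
* W. de Siqueira Pedra, M. Salmhofer, Comm. Math. Phys. 282 (2008) 797–818, Thm 1.3, Thm 2.4, Cor. 4.2.
  [cite: PedraSalmhofer2008, Thm 2.4]
* G. Benfatto, A. Giuliani, V. Mastropietro, Ann. Henri Poincaré 7 (2006) 809–898, §2.8 (2.80).
  [cite: BenfattoGiulianiMastropietro2006, §2.8 (2.80)]
-/

noncomputable section

open scoped Matrix ComplexOrder
open Finset NormedSpace

namespace Literature.MathematicalPhysics.QuantumLattice

variable {ι : Type*} [Fintype ι] [DecidableEq ι]

/-! ### Weighted minors: the determinant bound `δ = 2` in the sense of Salmhofer–Wieczerkowski -/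

/-- A downward-closed decidable predicate on `Fin n` holds exactly on an initial segment:
`P a ↔ a < #{a' | P a'}`. [folklore] -/
theorem iff_lt_card_filter_of_lower {n : ℕ} (P : Fin n → Prop) [DecidablePred P]
    (hP : ∀ a a' : Fin n, a' ≤ a → P a → P a') (a : Fin n) :
    P a ↔ (a : ℕ) < (univ.filter P).card := by
  constructor
  · intro ha
    have hsub : Finset.Iic a ⊆ univ.filter P := fun a' ha' =>
      mem_filter.mpr ⟨mem_univ _, hP a a' (Finset.mem_Iic.mp ha') ha⟩
    have := Finset.card_le_card hsub
    rw [Fin.card_Iic] at this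
    omega
  · intro ha
    by_contra hPa
    have hsub : univ.filter P ⊆ Finset.Iio a := fun a' ha' => by
      rw [Finset.mem_Iio]
      by_contra hle
      push Not at hle
      exact hPa (hP a' a hle (mem_filter.mp ha').2)
    have := Finset.card_le_card hsub
    rw [Fin.card_Iio] at this
    omega

/-- **Weighted minors of a chronological propagator matrix: the determinant bound `δ = 2`**
(de Siqueira Pedra–Salmhofer 2008, Thm 2.4 with Cor. 4.2, in the form of the "determinant bound" of
Salmhofer–Wieczerkowski / Benfatto–Giuliani–Mastropietro 2006 (2.80)): for a Hermitian one-body matrix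
`h`, any real `β`, `N` creation/annihilation pairs with orbitals `op, om` and real antitone times `t`
in a window of length `β`, arbitrary complex weight vectors `w_a, w'_b` (e.g. the Gram vectors of the
Brydges–Battle–Federbush interpolation), and MONOTONE row and column selections `er, ec : Fin n → Fin N`,
the `n × n` matrix `(⟨w_{er a}, w'_{ec b}⟩ · G_{er a, ec b})_{a,b}` built from `G = propMatrix β h op om t`
satisfies `‖det‖ ≤ 2ⁿ ∏ₐ ‖w_{er a}‖₂ ∏_b ‖w'_{ec b}‖₂` — uniformly in `β`, `h`, `N` and the volume. Proof:
tensor the unit eigen-mode vectors of `Matrix.IsHermitian.propagatorKernel_apply` with the weights and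
apply `norm_det_timeOrdered_modes_le` with the staircase pattern `k_b = #{a | er a ≤ ec b}`.
[cite: PedraSalmhofer2008, Thm 2.4] -/
theorem norm_det_weighted_propMatrix_minor_le {h : Matrix ι ι ℂ} (hh : h.IsHermitian) (β τ₀ : ℝ)
    {N : ℕ} (op om : Fin N → ι) (t : Fin N → ℝ) (ht : Antitone t)
    (hwin : ∀ a, τ₀ ≤ t a ∧ t a ≤ τ₀ + β)
    {m : Type*} [Fintype m] (w w' : Fin N → m → ℂ)
    {n : ℕ} (er ec : Fin n → Fin N) (her : Monotone er) (hec : Monotone ec) :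
    ‖(Matrix.of fun a b : Fin n =>
        (∑ r, star (w (er a) r) * w' (ec b) r) *
          propMatrix β h op om (fun c => ((t c : ℝ) : ℂ)) (er a) (ec b)).det‖ ≤
      2 ^ n * ((∏ a, Real.sqrt (∑ r, ‖w (er a) r‖ ^ 2)) *
        ∏ b, Real.sqrt (∑ r, ‖w' (ec b) r‖ ^ 2)) := by
  classical
  have hU : (hh.eigenvectorUnitary : Matrix ι ι ℂ) ∈ unitary (Matrix ι ι ℂ) :=
    hh.eigenvectorUnitary.prop
  -- the tensored mode data on `ι × m`
  set F : Fin n → ι × m → ℂ := fun a p =>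
    star ((hh.eigenvectorUnitary : Matrix ι ι ℂ) (op (er a)) p.1) * star (w (er a) p.2) with hF
  set G : Fin n → ι × m → ℂ := fun b p =>
    (hh.eigenvectorUnitary : Matrix ι ι ℂ) (om (ec b)) p.1 * w' (ec b) p.2 with hG
  set s : Fin n → ℝ := fun a => t (er a) - τ₀ with hs
  set s' : Fin n → ℝ := fun b => t (ec b) - τ₀ with hs'
  set d : ι × m → ℝ := fun p => hh.eigenvalues p.1 with hd
  -- the staircase pattern
  set k : Fin n → ℕ := fun b => (univ.filter fun a : Fin n => er a ≤ ec b).card with hk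
  have hpat : ∀ a b : Fin n, (a : ℕ) < k b ↔ er a ≤ ec b := fun a b => by
    rw [hk]
    exact (iff_lt_card_filter_of_lower (fun a : Fin n => er a ≤ ec b)
      (fun a a' haa' hab => (her haa').trans hab) a).symm
  -- the matrix in mode form
  have hM : (Matrix.of fun a b : Fin n =>
      (∑ r, star (w (er a) r) * w' (ec b) r) *
        propMatrix β h op om (fun c => ((t c : ℝ) : ℂ)) (er a) (ec b)) = Matrix.of fun a b : Fin n =>
      if (a : ℕ) < k b then
        ∑ p, F a p * G b p *
          ((Real.exp ((s a - s' b) * d p) * (1 + Real.exp (β * d p))⁻¹ : ℝ) : ℂ)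
      else -∑ p, F a p * G b p *
          ((Real.exp ((s a - s' b) * d p) * (1 + Real.exp (-(β * d p)))⁻¹ : ℝ) : ℂ) := by
    ext a b
    simp only [Matrix.of_apply, propMatrix]
    have hsab : s a - s' b = t (er a) - t (ec b) := by
      simp only [hs, hs']
      ring
    have hnegβ : -((β : ℂ) • h) = ((-β : ℝ) : ℂ) • h := by
      rw [Complex.ofReal_neg, neg_smul]
    have hsplit : ∀ K : ι → ℂ,
        (∑ r, star (w (er a) r) * w' (ec b) r) *
            (∑ i, (hh.eigenvectorUnitary : Matrix ι ι ℂ) (om (ec b)) i *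
              star ((hh.eigenvectorUnitary : Matrix ι ι ℂ) (op (er a)) i) * K i) =
          ∑ p : ι × m, F a p * G b p * K p.1 := fun K => by
      rw [Fintype.sum_prod_type, Finset.sum_comm, Finset.sum_mul]
      refine Finset.sum_congr rfl fun r _ => ?_
      rw [Finset.mul_sum]
      refine Finset.sum_congr rfl fun i _ => ?_
      simp only [hF, hG]
      ring
    by_cases hab : er a ≤ ec b
    · rw [if_pos hab, if_pos ((hpat a b).mpr hab),
        hh.propagatorKernel_apply (t (er a)) (t (ec b)) β (om (ec b)) (op (er a)), hsab]
      exact hsplit _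
    · rw [if_neg hab, if_neg (fun h' => hab ((hpat a b).mp h')), hnegβ,
        hh.propagatorKernel_apply (t (er a)) (t (ec b)) (-β) (om (ec b)) (op (er a)), hsab, mul_neg]
      congr 1
      simp only [neg_mul]
      exact hsplit _
  rw [hM]
  -- hypotheses of the mode bound
  have hs01 : ∀ a, 0 ≤ s a ∧ s a ≤ β := fun a => by
    simp only [hs]
    constructor <;> linarith [(hwin (er a)).1, (hwin (er a)).2]
  have hs'01 : ∀ b, 0 ≤ s' b ∧ s' b ≤ β := fun b => by
    simp only [hs']
    constructor <;> linarith [(hwin (ec b)).1, (hwin (ec b)).2]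
  have hkmono : Monotone k := fun b b' hbb' => by
    simp only [hk]
    exact Finset.card_le_card fun a ha => mem_filter.mpr
      ⟨mem_univ _, (mem_filter.mp ha).2.trans (hec hbb')⟩
  have hkn : ∀ b, k b ≤ n := fun b => by
    simp only [hk]
    exact (Finset.card_filter_le _ _).trans (by rw [Finset.card_fin])
  have hcons : ∀ a b : Fin n, ((a : ℕ) < k b → s' b ≤ s a) ∧ (¬ (a : ℕ) < k b → s a ≤ s' b) :=
    fun a b => by
    constructor
    · intro hab
      have := ht ((hpat a b).mp hab)
      simp only [hs, hs']
      linarith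
    · intro hab
      have hlt : ec b < er a := lt_of_not_ge fun h' => hab ((hpat a b).mpr h')
      have := ht hlt.le
      simp only [hs, hs']
      linarith
  have hPS := norm_det_timeOrdered_modes_le d β F G s s' hs01 hs'01 k hkmono hkn hcons
  -- the tensored norms factor
  have hFn : ∀ a, Real.sqrt (∑ p, ‖F a p‖ ^ 2) = Real.sqrt (∑ r, ‖w (er a) r‖ ^ 2) := fun a => by
    congr 1
    rw [Fintype.sum_prod_type]
    simp only [hF, norm_mul, norm_star, mul_pow]
    rw [← Finset.sum_mul_sum, Matrix.sum_norm_sq_row_eq_one hU, one_mul]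
  have hGn : ∀ b, Real.sqrt (∑ p, ‖G b p‖ ^ 2) = Real.sqrt (∑ r, ‖w' (ec b) r‖ ^ 2) := fun b => by
    congr 1
    rw [Fintype.sum_prod_type]
    simp only [hG, norm_mul, mul_pow]
    rw [← Finset.sum_mul_sum, Matrix.sum_norm_sq_row_eq_one hU, one_mul]
  simp only [hFn, hGn] at hPS
  exact hPS

/-- **Every square minor of a chronological propagator matrix is bounded by `2^{|rows|}`**: for
Hermitian `h`, real `β`, antitone real pair times in a window of length `β`, and row/column subsets
`R, C ⊆ Fin N` of equal size `n` (increasing enumerations), `‖det G[R, C]‖ ≤ 2ⁿ`. This is the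
weighted bound with trivial weights; with `R = C` it contains `norm_det_propMatrix_le_two_pow` for the
principal minors. [cite: PedraSalmhofer2008, Thm 2.4] -/
theorem norm_det_propMatrix_minor_le_two_pow {h : Matrix ι ι ℂ} (hh : h.IsHermitian) (β τ₀ : ℝ)
    {N : ℕ} (op om : Fin N → ι) (t : Fin N → ℝ) (ht : Antitone t)
    (hwin : ∀ a, τ₀ ≤ t a ∧ t a ≤ τ₀ + β)
    {n : ℕ} (er ec : Fin n → Fin N) (her : Monotone er) (hec : Monotone ec) :
    ‖((propMatrix β h op om (fun c => ((t c : ℝ) : ℂ))).submatrix er ec).det‖ ≤ 2 ^ n := by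
  have key := norm_det_weighted_propMatrix_minor_le hh β τ₀ op om t ht hwin
    (fun _ _ => (1 : ℂ)) (fun _ _ => (1 : ℂ)) (m := Unit) er ec her hec
  simp only [Finset.univ_unique, Finset.sum_singleton, star_one, mul_one, norm_one, one_pow,
    Real.sqrt_one, Finset.prod_const_one, one_mul] at key
  have hmat : (Matrix.of fun a b : Fin n => propMatrix β h op om (fun c => ((t c : ℝ) : ℂ)) (er a) (ec b)) =
      (propMatrix β h op om (fun c => ((t c : ℝ) : ℂ))).submatrix er ec := by
    ext a b
    rfl
  rw [hmat] at key
  exact key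

end Literature.MathematicalPhysics.QuantumLattice
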